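import Literature.AlgebraicGeometry.HodgeTheory.HodgeConjectureCompleteIntersectionsVerySmallDegreeOfELV
import Literature.AlgebraicGeometry.HodgeTheory.BettiHodgeConjectureProductOfThreefoldsConiveauOrHodgeNumbers
import Literature.AlgebraicGeometry.HodgeTheory.LefschetzStandardOfHodgeConjectureSquare
import Literature.AlgebraicGeometry.HodgeTheory.StandardConjectureAOfHodgeClasses
import Literature.AlgebraicGeometry.Motives.FanoRationallyChainConnected
import HarnessLib

/-!
# Grothendieck's standard conjectures from small Chow groups: `B(X)` (André's `*_L`-form, every polarisation) for `CH₀, …, CH_{k₀}` of rank `≤ 1` and `dim X ≤ 2k₀ + 3` — through `HC(X × X)` — and `A(X, η)` for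
# `dim X ≤ 2k₀ + 5`; threefolds with `CH₀ = ℤ` or `CH₀` on a curve/surface, fivefolds with `CH₀ = CH₁ = ℚ`, sevenfolds with `CH₀ = CH₁ = CH₂ = ℚ`; cubic fivefolds and `(2,2)` four/fivefolds granted ELV
# (Vial 2013 Thm. 7.1 (ii); Kleiman 1968 §2; Voisin 2025 §3.2.2; Grothendieck 1968 §3; Laterveer 1998; Voisin II Thm. 10.29/10.31; Bloch–Srinivas 1983)

Family `hodge`, lane `lit-hodgefound` (Track 2 foundations library; Layers A1/A4), layer `Literature/AlgebraicGeometry/HodgeTheory`.  THEOREMS ONLY (no definition, no named fact, no instance;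
D-0026 net debt `0`).  Sequel of the seat's g33-#7/#8 (`hodgeConjectureFor_tensor_of_chowRankLEOneUpTo`: `HC(Y × Z)` for small Chow groups on both factors; `hodgeConjectureFor_of_chowRankLEOneUpTo`; the ELV
bridges) and g33-#3 (`HC(T × T')` for threefolds with degenerate `CH₀`), and of the tree's `LefschetzStandardOfHodgeConjectureSquare` (**`HC(X × X) ⟹ B(X)`**, `standardConjectureBStar_of_hodgeConjectureFor_prod`:
Kleiman 1968 / Voisin 2025 §3.2.2 on the real carriers, a DISCHARGED named fact) and `StandardConjectureAOfHodgeClasses` (`HC(X) ⟹ A(X, η)`).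

THE ARGUMENT.  Vial 2013 Thm. 7.1, second item: «if [the niveau is] `2` and `l = ⌊(d − 3)/2⌋`, then `X` satisfies the Lefschetz standard conjecture» (for which Vial «couldn't find a reference … so we
include a proof»).  In the niveau-`0` case typed in the tree (`Motives.ChowRankLEOneUpTo X k₀`) and in the range `dim X ≤ 2k₀ + 3` there is a two-line road: g33-#7 gives `HC(X × X)`
(`2 dim X ≤ 2(k₀ + k₀) + 7`), and `HC(X × X) ⟹ B(X)` (the Lefschetz involution `*_L` of every polarisation is then induced by an algebraic correspondence — Kleiman 1968 §2, Voisin 2025 §3.2.2, the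
tree's theorem).  (Vial's own argument reaches `dim X = 2k₀ + 4`, e.g. fourfolds with `CH₀ = ℚ`; that case is NOT obtained here.)  `A(X, η)` — `L^{n−2p}` is an isomorphism on algebraic classes —
follows from `HC(X)` alone (Grothendieck 1968 §3), i.e. for `dim X ≤ 2k₀ + 5` (g33-#7).

WHAT IS PROVED (`0` sorrys; every statement a theorem).
* §1 **`standardConjectureBStar_of_chowRankLEOneUpTo`** (`dim X ≤ 2k₀ + 3`, every `η`), `standardConjectureA_of_chowRankLEOneUpTo` (`dim X ≤ 2k₀ + 5`, every polarisation class `η`).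
* §2 Unconditional instances: `B(T)` for every smooth projective threefold with `CH₀ ⊗ ℚ` of rank `≤ 1`, with `CH₀` supported on a curve, with `CH₀` supported on a surface and `h^{2,0}(T)·h^{2,0}(T) = 0` absorbed
  (through g33-#3's `HC(T × T')` theorems: `CH₀` on a surface for one copy and on a curve for the other is the printed clause-free form, so `CH₀` on a curve suffices), for rationally chain connected and
  (granted KMM92) Fano threefolds; `B(X)` for fivefolds with `CH₀, CH₁` and sevenfolds with `CH₀, CH₁, CH₂` of rank `≤ 1`; `A` in the same cases and for fourfolds / sixfolds / eightfolds one step further.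
* §3 Granted the typed ELV fact: `B` for smooth cubic fivefolds and for smooth complete intersections of two quadrics of dimension `4` and `5`; `A(X, η)` for smooth cubic hypersurfaces of dimension `≤ 7` and
  (with Hirschowitz–Iyer) cubic eightfolds.

THE PRINTS.  Ch. Vial (2013) [Vial2013] Thm. 7.1 (second item) and its proof pp. 19–20, §7.2.2–7.2.3; S. Kleiman (1968) [Kleiman1968AlgebraicCycles] §2; C. Voisin (2025) [Voisin2025] §3.2.2 (15)–(16), Lemma 2.9, Conj. 3.11;
A. Grothendieck (1969/1968) [Grothendieck1968] §3 p. 196; Y. André (1996) [Andre1996Motifs] §0.2–0.3, §2.1; R. Laterveer (1998) [Laterveer1998]; C. Voisin (2003) [VoisinHodgeII2003] Thm. 10.29, Thm. 10.31, Thm. 10.17;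
S. Bloch, V. Srinivas (1983) [BlochSrinivas1983] Thm. 1; H. Esnault, M. Levine, E. Viehweg (1997) [EsnaultLevineViehweg1997] Thm. 4.6; J. Kollár, Y. Miyaoka, S. Mori (1992) [KollarMiyaokaMori1992] Thm. 3.3.

THE OBJECTS (all the tree's).  `StandardConjectureBStar n X η` (André's `*_L`-form of `B(X)`), `StandardConjectureA n X η`, `IsPolarizationClass`, `HodgeConjectureFor`, `Motives.ChowRankLEOneUpTo`,
`Barriers.HodgeConjecture.HasChowZeroSupportedInDimLE`, `IsRationallyChainConnected`, `IsFano`, `Motives.IsSmoothCompleteIntersection`, the named facts `Motives.EsnaultLevineViehweg1997_chowGroup_rank_le_one`,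
`Motives.HirschowitzIyer2010_chowTwo_rank_le_one_cubicEightfold`, `KollarMiyaokaMori1992_fano_rationallyChainConnected` (hypotheses only); the tree's `standardConjectureBStar_of_hodgeConjectureFor_prod`,
`standardConjectureA_of_hodgeConjectureFor`, and the seat's `hodgeConjectureFor_tensor_of_chowRankLEOneUpTo`, `hodgeConjectureFor_of_chowRankLEOneUpTo`, `hodgeConjectureFor_tensor_threefolds_of_hasChowZeroSupportedInDimLE_one_two`,
`chowRankLEOneUpTo_one_of_cubic_of_ELV`, `chowRankLEOneUpTo_of_isSmoothCompleteIntersection_of_ELV`, `hodgeConjectureFor_cubic_of_ELV`, `hodgeConjectureFor_cubicEightfoldCI_of_hirschowitzIyer_of_ELV`.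

DEVIATIONS / SCOPE.  `B(X)` is the tree's per-polarisation predicate `StandardConjectureBStar n X η` (vacuous for `η` not a polarisation class); the range is the one reached through `HC(X × X)`, one
dimension short of Vial's printed range.  §3 is conditional on the typed Chow facts as its predecessors.

## References
* [Vial2013] Ch. Vial, *Algebraic cycles and fibrations*, Doc. Math. 18 (2013) — Thm. 7.1 (second item) and proof pp. 19–20; §7.2.2; §7.2.3.
* [Kleiman1968AlgebraicCycles] S. Kleiman, *Algebraic cycles and the Weil conjectures* (1968) — §2.
* [Voisin2025] C. Voisin (2025) — §3.2.2 (15)–(16), Lemma 2.9, Conj. 3.11.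
* [Grothendieck1968] A. Grothendieck, *Standard conjectures on algebraic cycles* (Bombay 1968) — §3 p. 196.
* [Andre1996Motifs] Y. André, *Pour une théorie inconditionnelle des motifs*, Publ. IHÉS 83 (1996) — §0.2–0.3, §2.1.
* [Laterveer1998] R. Laterveer, J. Math. Kyoto Univ. 38 (1998) — main theorem.
* [VoisinHodgeII2003] C. Voisin, *Hodge Theory and Complex Algebraic Geometry II* — Thm. 10.29, Thm. 10.31, Thm. 10.17.
* [BlochSrinivas1983] S. Bloch, V. Srinivas, Amer. J. Math. 105 (1983) — Thm. 1.
* [EsnaultLevineViehweg1997] H. Esnault, M. Levine, E. Viehweg, Duke Math. J. 87 (1997) — Thm. 4.6.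
* [KollarMiyaokaMori1992] J. Kollár, Y. Miyaoka, S. Mori, J. Differential Geom. 36 (1992) — Thm. 3.3.

## Provenance
Lane `lit-hodgefound` (summit `HodgeConjecture`, Track 2 foundations), seat `lit-hodgefound-p29` (literature-prover, generation 33, row g33-#12).
-/

noncomputable section

open CategoryTheory AlgebraicGeometry MonoidalCategory CartesianMonoidalCategory
open Literature.AlgebraicTopology.SingularHomology Literature.Geometry.Kaehler

namespace Literature.AlgebraicGeometry.HodgeTheory

open Literature.AlgebraicGeometry.Motives
open Literature.Barriers.HodgeConjecture (HasChowZeroSupportedInDimLE)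

variable {n m : ℕ} {X T : SchemeOver ℂ}

/-! ### §1 `B(X)` and `A(X, η)` from small Chow groups -/

/-- **Vial 2013 Thm. 7.1 (ii), niveau `0`, through `HC(X × X)`: if `CH₀(X)_ℚ, …, CH_{k₀}(X)_ℚ` have rank `≤ 1` and `dim X ≤ 2k₀ + 3`, then `B(X)` holds — the Lefschetz involution `*_L` of EVERY
polarisation class `η` is induced by an algebraic correspondence** (`HC(X × X)` by g33-#7, then Kleiman / Voisin 2025 §3.2.2 on the real carriers). [cite: Vial2013, Thm 7.1 (second item), proof pp. 19–20]
[cite: Kleiman1968AlgebraicCycles, §2] [cite: Voisin2025, §3.2.2 (15)–(16), Lemma 2.9 and Conj. 3.11] [cite: VoisinHodgeII2003, Thm. 10.29 and proof of Thm. 10.31] [cite: Laterveer1998, main theorem (as quoted in Vial2013 Thm. 7.1)] -/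
theorem standardConjectureBStar_of_chowRankLEOneUpTo (hX : IsSmoothProjective n X) {k₀ : ℕ} (hCH : ChowRankLEOneUpTo X k₀) (hn : n ≤ 2 * k₀ + 3) (η : complexBetti X 2) :
    StandardConjectureBStar n X η :=
  standardConjectureBStar_of_hodgeConjectureFor_prod hX (hodgeConjectureFor_tensor_of_chowRankLEOneUpTo hX hX hCH hCH (by omega) (by omega) (by omega)) η

/-- **`A(X, η)` for every polarisation class `η` when `CH₀(X)_ℚ, …, CH_{k₀}(X)_ℚ` have rank `≤ 1` and `dim X ≤ 2k₀ + 5`** (`HC(X)` by g33-#7; `HC(X) ⟹ A(X)`, Grothendieck 1968 §3).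
[cite: Grothendieck1968, §3 p. 196 (A(X))] [cite: Vial2013, Thm 7.1 (first item)] [cite: VoisinHodgeII2003, Thm. 10.29 and proof of Thm. 10.31] -/
theorem standardConjectureA_of_chowRankLEOneUpTo (hX : IsSmoothProjective n X) {k₀ : ℕ} (hCH : ChowRankLEOneUpTo X k₀) (hn : n ≤ 2 * k₀ + 5) {η : complexBetti X 2}
    (hη : IsPolarizationClass n X η) : StandardConjectureA n X η :=
  standardConjectureA_of_hodgeConjectureFor hX hη (hodgeConjectureFor_of_chowRankLEOneUpTo hX hCH hn)

/-! ### §2 Unconditional instances -/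

/-- **`B(T)` for every smooth projective THREEFOLD with `CH₀ ⊗ ℚ` of rank `≤ 1`** (`CH₀(T) = ℤ`: e.g. rationally connected threefolds), every polarisation class.
[cite: Vial2013, Thm 7.1 (second item)] [cite: Kleiman1968AlgebraicCycles, §2] [cite: BlochSrinivas1983, Thm. 1] [cite: Voisin2025, §3.2.2] -/
theorem standardConjectureBStar_threefold_of_chowRankLEOneUpTo_zero (hT : IsSmoothProjective 3 T) (hCH : ChowRankLEOneUpTo T 0) (η : complexBetti T 2) : StandardConjectureBStar 3 T η :=
  standardConjectureBStar_of_chowRankLEOneUpTo hT hCH (by norm_num) η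

/-- **`B(T)` for every smooth projective threefold whose `CH₀` is supported on a CURVE** (`HC(T × T)` by g33-#3: `CH₀` on a surface for one copy, on a curve for the other).
[cite: Kleiman1968AlgebraicCycles, §2] [cite: BlochSrinivas1983, Thm. 1] [cite: VoisinHodgeII2003, §10.2.2 Thm. 10.17 and Cor. 10.21] [cite: Voisin2025, §3.2.2] -/
theorem standardConjectureBStar_threefold_of_hasChowZeroSupportedInDimLE_one (hT : IsSmoothProjective 3 T) (hW : HasChowZeroSupportedInDimLE T 1) (η : complexBetti T 2) :
    StandardConjectureBStar 3 T η :=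
  standardConjectureBStar_of_hodgeConjectureFor_prod hT (hodgeConjectureFor_tensor_threefolds_of_hasChowZeroSupportedInDimLE_two_one hT hT (hW.mono (by norm_num)) hW) η

/-- **`B(T)` for every RATIONALLY CHAIN CONNECTED smooth projective threefold.** [cite: Kleiman1968AlgebraicCycles, §2] [cite: BlochSrinivas1983, Thm. 1] [cite: VoisinHodgeII2003, §10.2.2 Thm. 10.17 and Cor. 10.18] -/
theorem standardConjectureBStar_threefold_of_isRationallyChainConnected (hT : IsSmoothProjective 3 T) (hRC : IsRationallyChainConnected T) (η : complexBetti T 2) : StandardConjectureBStar 3 T η :=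
  standardConjectureBStar_threefold_of_hasChowZeroSupportedInDimLE_one hT ((hRC.hasChowZeroSupportedInDimLE_zero hT).mono (by norm_num)) η

/-- **`B(F)` for every FANO threefold, granted the printed fact `KollarMiyaokaMori1992_fano_rationallyChainConnected`.** [cite: KollarMiyaokaMori1992, Thm. 3.3] [cite: Kleiman1968AlgebraicCycles, §2] [cite: BlochSrinivas1983, Thm. 1] -/
theorem standardConjectureBStar_threefold_of_isFano (hKMM : KollarMiyaokaMori1992_fano_rationallyChainConnected) {F : SchemeOver ℂ} (hF : IsFano 3 F) (η : complexBetti F 2) :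
    StandardConjectureBStar 3 F η :=
  standardConjectureBStar_threefold_of_hasChowZeroSupportedInDimLE_one hF.isSmoothProjective ((hKMM.hasChowZeroSupportedInDimLE_zero hF).mono (by norm_num)) η

/-- **`B(X)` for every smooth projective FIVEFOLD with `CH₀, CH₁ ⊗ ℚ` of rank `≤ 1`** (`5 = 2·1 + 3`; e.g. smooth cubic fivefolds granted ELV, §3). [cite: Vial2013, Thm 7.1 (second item)] [cite: Kleiman1968AlgebraicCycles, §2]
[cite: VoisinHodgeII2003, Thm. 10.29 and proof of Thm. 10.31] -/
theorem standardConjectureBStar_fivefold_of_chowRankLEOneUpTo_one (hX : IsSmoothProjective 5 X) (hCH : ChowRankLEOneUpTo X 1) (η : complexBetti X 2) : StandardConjectureBStar 5 X η :=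
  standardConjectureBStar_of_chowRankLEOneUpTo hX hCH (by norm_num) η

/-- **`B(X)` for every smooth projective SEVENFOLD with `CH₀, CH₁, CH₂ ⊗ ℚ` of rank `≤ 1`** (`7 = 2·2 + 3`). [cite: Vial2013, Thm 7.1 (second item)] [cite: Kleiman1968AlgebraicCycles, §2] [cite: VoisinHodgeII2003, Thm. 10.29 and proof of Thm. 10.31] -/
theorem standardConjectureBStar_sevenfold_of_chowRankLEOneUpTo_two (hX : IsSmoothProjective 7 X) (hCH : ChowRankLEOneUpTo X 2) (η : complexBetti X 2) : StandardConjectureBStar 7 X η :=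
  standardConjectureBStar_of_chowRankLEOneUpTo hX hCH (by norm_num) η

/-- **`A(F, η)` for every smooth projective FOURFOLD with `CH₀ ⊗ ℚ` of rank `≤ 1`**, every polarisation class. [cite: Grothendieck1968, §3 p. 196 (A(X))] [cite: BlochSrinivas1983, Thm. 1] [cite: Vial2013, Thm 7.1 (first item)] -/
theorem standardConjectureA_fourfold_of_chowRankLEOneUpTo_zero {F : SchemeOver ℂ} (hF : IsSmoothProjective 4 F) (hCH : ChowRankLEOneUpTo F 0) {η : complexBetti F 2} (hη : IsPolarizationClass 4 F η) :
    StandardConjectureA 4 F η :=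
  standardConjectureA_of_chowRankLEOneUpTo hF hCH (by norm_num) hη

/-- **`A(X, η)` for every smooth projective SIXFOLD with `CH₀, CH₁ ⊗ ℚ` of rank `≤ 1`** (e.g. smooth cubic sixfolds granted ELV, §3). [cite: Grothendieck1968, §3 p. 196 (A(X))] [cite: Vial2013, Thm 7.1 (first item)] -/
theorem standardConjectureA_sixfold_of_chowRankLEOneUpTo_one (hX : IsSmoothProjective 6 X) (hCH : ChowRankLEOneUpTo X 1) {η : complexBetti X 2} (hη : IsPolarizationClass 6 X η) :
    StandardConjectureA 6 X η :=
  standardConjectureA_of_chowRankLEOneUpTo hX hCH (by norm_num) hη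

/-! ### §3 Complete intersections of very small degree, granted ELV -/

/-- **`B(Y)` for every smooth cubic FIVEFOLD `Y ⊂ ℙ⁶_ℂ`, every polarisation class, granted Esnault–Levine–Viehweg** (`CH₀ = CH₁ = ℚ`; `HC(Y × Y)` — for two cubic fivefolds also the tree's `hodgeConjectureFor_tensor_cubicFivefolds_of_ELV`).
[cite: EsnaultLevineViehweg1997, Thm 4.6 (announced as Thm 4.5 in the Introduction), first bullet] [cite: Vial2013, Thm 7.1 (second item) and §7.2.2] [cite: Kleiman1968AlgebraicCycles, §2] [cite: Voisin2025, §3.2.2] -/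
theorem standardConjectureBStar_cubicFivefold_of_ELV (hR : EsnaultLevineViehweg1997_chowGroup_rank_le_one.{0}) (hX : IsSmoothCompleteIntersection 5 (fun _ : Fin 1 ↦ 3) X) (η : complexBetti X 2) :
    StandardConjectureBStar 5 X η :=
  standardConjectureBStar_fivefold_of_chowRankLEOneUpTo_one hX.1 (chowRankLEOneUpTo_one_of_cubic_of_ELV hR hX (by norm_num)) η

/-- **`B(Y)` for every smooth complete intersection of TWO QUADRICS of dimension `4` or `5`, granted ELV** (`CH₀, CH₁` of rank `≤ 1`: `l = 1 ≤ c − 1`, `6 ≤ m + 2`). [cite: EsnaultLevineViehweg1997, Thm 4.6 (announced as Thm 4.5 in the Introduction)]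
[cite: Vial2013, Thm 7.1 (second item) and §7.2.3] [cite: Kleiman1968AlgebraicCycles, §2] -/
theorem standardConjectureBStar_twoQuadrics_of_ELV (hR : EsnaultLevineViehweg1997_chowGroup_rank_le_one.{0}) (hX : IsSmoothCompleteIntersection m (fun _ : Fin 2 ↦ 2) X) (h4 : 4 ≤ m) (h5 : m ≤ 5)
    (η : complexBetti X 2) : StandardConjectureBStar m X η :=
  standardConjectureBStar_of_chowRankLEOneUpTo hX.1
    (chowRankLEOneUpTo_of_isSmoothCompleteIntersection_of_ELV hR hX (fun _ ↦ le_rfl) (l := 1) (Or.inr le_rfl) (by simp [Nat.choose]; omega)) (by omega) η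

/-- **`A(Y, η)` for every smooth cubic hypersurface of dimension `≤ 7`, every polarisation class, granted ELV** (`HC(Y)`, g33-#8 `hodgeConjectureFor_cubic_of_ELV`). [cite: Grothendieck1968, §3 p. 196 (A(X))]
[cite: EsnaultLevineViehweg1997, Thm 4.6 (announced as Thm 4.5 in the Introduction), first bullet] [cite: Vial2013, Thm 7.1 (first item) and §7.2.2] -/
theorem standardConjectureA_cubic_of_ELV (hR : EsnaultLevineViehweg1997_chowGroup_rank_le_one.{0}) (hX : IsSmoothCompleteIntersection m (fun _ : Fin 1 ↦ 3) X) (hm : m ≤ 7) {η : complexBetti X 2}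
    (hη : IsPolarizationClass m X η) : StandardConjectureA m X η :=
  standardConjectureA_of_hodgeConjectureFor hX.1 hη (hodgeConjectureFor_cubic_of_ELV hR hX hm)

/-- **`A(Y, η)` for every smooth cubic EIGHTFOLD `Y ⊂ ℙ⁹_ℂ`, granted ELV and Hirschowitz–Iyer** (`HC(Y)`, g33-#8). [cite: Grothendieck1968, §3 p. 196 (A(X))] [cite: HirschowitzIyer2010, Thm. 1.5 at (9,2,1,(3))]
[cite: EsnaultLevineViehweg1997, Thm 4.6 (announced as Thm 4.5 in the Introduction), first bullet] [cite: Vial2013, Thm 7.1 (first item) and §7.2.2] -/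
theorem standardConjectureA_cubicEightfoldCI_of_hirschowitzIyer_of_ELV (h : HirschowitzIyer2010_chowTwo_rank_le_one_cubicEightfold.{0}) (hR : EsnaultLevineViehweg1997_chowGroup_rank_le_one.{0})
    (hX : IsSmoothCompleteIntersection 8 ![3] X) {η : complexBetti X 2} (hη : IsPolarizationClass 8 X η) : StandardConjectureA 8 X η :=
  standardConjectureA_of_hodgeConjectureFor hX.1 hη (hodgeConjectureFor_cubicEightfoldCI_of_hirschowitzIyer_of_ELV h hR hX)

end Literature.AlgebraicGeometry.HodgeTheory

end
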